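import Summits.QuantumAdvantage.AdviceFreeQNC0.TwoBlindSpotsFlip
import Summits.QuantumAdvantage.AdviceFreeQNC0.BlindWindowPolylog
import Summits.QuantumAdvantage.AdviceFreeQNC0.CrossFreeWindow
import Summits.QuantumAdvantage.AdviceFreeQNC0.WalkCoreBasics
import HarnessLib

/-!
# Cell qa-qnc0 (rung F-Q1, route RingFrame, crux α `RingToElim`): TWO BLIND SPOTS⁺ — the fibre
# lemmas when degree is only needed TOWARDS the block (planner qa-qnc0-p1's T8⁺, Sketch11 §23.1⁺)

THEOREM-TARGET T8⁺ (planner qa-qnc0-p1 gen 11, ROUND-10 §1 / `Sketch11` §23.1⁺ `TwoBlindSpotsPlus`):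
the two-blind-spots theorem with NO global degree hypothesis.  Block `z = [p, p+M)`, an adjacent
pair of bits `{t, t+1}` outside it; per cut: strictly inside the block ⇒ BLIND to the pair (any
complexity); the cut `t + 1` between the pair ⇒ degree `≤ D` TOWARDS the block (`HasDegTowards`:
as a function of the block bits for every fixing of the rest); every other cut ⇒ blind to the pair
OR of degree `≤ D` towards the block.  This file proves the fibre lemmas; the theorem is
`twoBlindSpotsPlus` (`TwoBlindSpotsPlus.lean`).

Vocabulary (Sketch11 §23.1⁺, verbatim): `blockWrite`, `HasDegTowards`, `BlindPair`.

Mechanism.  On the fibre `u = a ++ z ++ b` (outside blocks fixed) split the cuts into the LIGHT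
ones (non-interior, of degree `≤ D` towards the block; a set `Lt`) and the rest (`univ \ Lt`, all
blind to the pair and none equal to `t + 1`): `WIN = E ⊕ B` (`ringWinU_eq_xor_parts`).
* `isElimFail_not_lightPart` — a light cut `g` has character `gapChar(g, |z|)` (it is not strictly
  inside the block), live for exactly two residues of `|z|`, and a selector of degree `≤ D` in `z`
  (`hasDeg_glue3_of_towards`): the light part `E(z)` is an even-triple pattern `T_{|z| mod 3}(z)`,
  the complement of an elimination FAIL pattern (E1 `failCompl_iff_evenTriple`).
* `blindPart_flip` — flipping the pair bit `u_k` (`k ∈ {t, t+1}`) does not change the selectors of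
  the blind cuts and moves the character of a blind cut `g` by `m_g·ε` (mod 3), `m_g = 1` for
  `g ≤ t`, `m_g = 2` for `g ≥ t + 2` (`walkExp_flip_mod`), `ε = 1` if the bit was `0`, `2` if it
  was `1`: the blind part on the flipped input is `B_{σ + ε}` where `B_σ(z)` counts the blind cuts
  with character shifted by `m_g σ`.
* `blindPart_xor3` — `B_0 ⊕ B_1 ⊕ B_2 ≡ 0` (each blind cut is live for two of the three shifts).

The cell's lemmas (planner qa-qnc0-p1 gen 11, statement and sketch; prover qn-prover-3 gen 4,
proof), 2026-08-27; not in print.  WHAT THIS IS NOT: nothing on α by itself; no separation.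
-/

noncomputable section

namespace Summit.QuantumAdvantage.AdviceFreeQNC0

open Finset
open Literature.Computability.MetaComplexity Literature.Computability.MetaComplexity.Smolensky

/-! ### Vocabulary (verbatim from `Sketch11` §23.1⁺) -/

/-- Overwrite the block `[p, p+M)` of `w` with `z`. -/
def blockWrite {n : ℕ} (p M : ℕ) (w : Fin n → Bool) (z : Fin M → Bool) : Fin n → Bool :=
  fun i => if h : p ≤ i.val ∧ i.val < p + M then z ⟨i.val - p, by omega⟩ else w i

/-- `f` has degree `≤ D` TOWARDS the block `[p, p+M)`: as a function of the block bits, for every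
fixing of the others. (Implied by `HasDeg f D`; a `J`-junta has it with `D = #(support ∩ block)`.) -/
def HasDegTowards {n : ℕ} (p M D : ℕ) (f : (Fin n → Bool) → Bool) : Prop :=
  ∀ w : Fin n → Bool, HasDeg (fun z : Fin M → Bool => f (blockWrite p M w z)) D

/-- `f` is blind to the two positions `t, t+1`. -/
def BlindPair {n : ℕ} (t : ℕ) (f : (Fin n → Bool) → Bool) : Prop :=
  ∀ u u' : Fin n → Bool, (∀ i : Fin n, i.val ≠ t → i.val ≠ t + 1 → u i = u' i) → f u = f u'

/-! ### Small tools -/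

/-- Parities add. -/
private theorem decide_odd_add₄ (a b : ℕ) :
    decide ((a + b) % 2 = 1) = xor (decide (a % 2 = 1)) (decide (b % 2 = 1)) := by
  rcases Nat.mod_two_eq_zero_or_one a with ha | ha <;>
    rcases Nat.mod_two_eq_zero_or_one b with hb | hb <;> simp [Nat.add_mod, ha, hb]

variable {p M q : ℕ}

/-! ### Degree towards the block, on a glued fibre -/

/-- Overwriting the block of `a ++ z ++ b` with `z'` gives `a ++ z' ++ b`. -/
theorem blockWrite_glue3 (a : Fin p → Bool) (z z' : Fin M → Bool) (b : Fin q → Bool) :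
    blockWrite p M (glue3 a z b) z' = glue3 a z' b := by
  funext k
  unfold blockWrite
  by_cases hk : p ≤ k.val ∧ k.val < p + M
  · rw [dif_pos hk, glue3_apply_mid a z' b k hk.1 hk.2]
  · rw [dif_neg hk]
    have hk' : k.val < p ∨ p + M ≤ k.val := by have := k.isLt; omega
    rcases hk' with h | h
    · rw [glue3_apply_lt a z b k h, glue3_apply_lt a z' b k h]
    · rw [glue3_apply_ge a z b k h, glue3_apply_ge a z' b k h]

/-- A selector of degree `≤ D` towards the block has degree `≤ D` on every glued fibre. -/
theorem hasDeg_glue3_of_towards {D : ℕ} {f : (Fin (p + M + q) → Bool) → Bool}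
    (hf : HasDegTowards p M D f) (a : Fin p → Bool) (b : Fin q → Bool) :
    HasDeg (fun z : Fin M → Bool => f (glue3 a z b)) D := by
  have h := hf (glue3 a (fun _ => false) b)
  simp only [blockWrite_glue3] at h
  exact h

/-! ### Walk characters under a bit flip -/

/-- Prefix weight after an update: `W_g(update u k v) + [k < g ∧ u_k] = W_g(u) + [k < g ∧ v]`. -/
theorem wtPrefix_update_add {n : ℕ} (u : Fin n → Bool) (k : Fin n) (v : Bool) (g : ℕ) :
    wtPrefix (Function.update u k v) g + (if k.val < g ∧ u k = true then 1 else 0) =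
      wtPrefix u g + (if k.val < g ∧ v = true then 1 else 0) := by
  classical
  unfold wtPrefix
  rw [Finset.card_filter, Finset.card_filter]
  rw [← Finset.add_sum_erase _ _ (Finset.mem_univ k), ← Finset.add_sum_erase _ _ (Finset.mem_univ k)]
  have hrest : ∑ x ∈ univ.erase k, (if x.val < g ∧ Function.update u k v x = true then 1 else 0) =
      ∑ x ∈ univ.erase k, (if x.val < g ∧ u x = true then 1 else 0) :=
    Finset.sum_congr rfl fun x hx => by rw [Function.update_of_ne (Finset.ne_of_mem_erase hx)]
  rw [hrest, Function.update_self]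
  ring

/-- **The walk character under a bit flip.**  Flipping `u_k` moves `c + g + |u| + W_g(u)` by
`m·ε` (mod 3) with `m = 1 + [k < g]` and `ε = 1` if `u_k = 0`, `ε = 2` if `u_k = 1`. -/
theorem walkExp_flip_mod {n : ℕ} (u : Fin n → Bool) (k : Fin n) (g C : ℕ) :
    (C + walkExp (Function.update u k (!u k)) g) % 3 =
      (C + walkExp u g + (1 + if k.val < g then 1 else 0) * (if u k = true then 2 else 1)) % 3 := by
  have hw := wt_update_add u k (!u k)
  have hp := wtPrefix_update_add u k (!u k) g
  unfold walkExp
  rcases hu : u k with _ | _ <;> rw [hu] at hw hp <;> by_cases hkg : k.val < g <;>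
    simp only [hkg, Bool.not_false, Bool.not_true, Bool.false_eq_true, if_true, if_false,
      and_true, and_false, and_self] at hw hp ⊢ <;> omega

/-! ### Splitting the win bit along a set of cuts -/

/-- The win bit is the XOR of the parity of the selected live cuts in `Lt` and of those outside
`Lt`. -/
theorem ringWinU_eq_xor_parts {n : ℕ} (Lt : Finset (Fin (n + 1))) (c : ℕ)
    (y : Fin (n + 1) → (Fin n → Bool) → Bool) (u : Fin n → Bool) :
    ringWinU c y u =
      xor (decide ((Lt.filter fun g => y g u = true ∧ (c + g.val + walkExp u g.val) % 3 ≠ 0).card % 2 = 1))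
        (decide ((((univ : Finset (Fin (n + 1))) \ Lt).filter fun g =>
          y g u = true ∧ (c + g.val + walkExp u g.val) % 3 ≠ 0).card % 2 = 1)) := by
  classical
  unfold ringWinU
  set S := univ.filter fun g : Fin (n + 1) => y g u = true ∧ (c + g.val + walkExp u g.val) % 3 ≠ 0
    with hS
  have hsplit := Finset.card_filter_add_card_filter_not (s := S) (fun g => g ∈ Lt)
  have h1 : S.filter (fun g => g ∈ Lt) =
      Lt.filter fun g => y g u = true ∧ (c + g.val + walkExp u g.val) % 3 ≠ 0 := by
    ext g
    simp only [hS, Finset.mem_filter, Finset.mem_univ, true_and]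
    tauto
  have h2 : S.filter (fun g => ¬ g ∈ Lt) =
      ((univ : Finset (Fin (n + 1))) \ Lt).filter fun g =>
        y g u = true ∧ (c + g.val + walkExp u g.val) % 3 ≠ 0 := by
    ext g
    simp only [hS, Finset.mem_filter, Finset.mem_univ, true_and, Finset.mem_sdiff]
    tauto
  rw [← hsplit, h1, h2, decide_odd_add₄]

/-! ### The light part is an even-triple pattern -/

/-- The character of a cut not strictly inside the block, on `a ++ z ++ b`, is `gapChar(g, |z|)`. -/
theorem char_glue3_eq_gapChar (c : ℕ) (a : Fin p → Bool) (z : Fin M → Bool) (b : Fin q → Bool)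
    {g : ℕ} (hg : g ≤ p ∨ p + M ≤ g) :
    (c + g + walkExp (glue3 a z b) g) % 3 = gapChar M c a b g (wt z) % 3 := by
  unfold walkExp gapChar
  by_cases h1 : g ≤ p
  · rw [if_pos h1, wt_glue3, wtPrefix_glue3_of_le a z b h1]
  · have h2 : p + M ≤ g := by omega
    rw [if_neg h1, wt_glue3, wtPrefix_glue3_of_ge a z b h2]

/-- Each cut outside the block interior is live for exactly two residues of `|z|`. -/
theorem gapChar_xor3 (c : ℕ) (a : Fin p → Bool) (b : Fin q → Bool) (g : ℕ) :
    xor (decide (gapChar M c a b g 0 % 3 ≠ 0)) (xor (decide (gapChar M c a b g 1 % 3 ≠ 0))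
      (decide (gapChar M c a b g 2 % 3 ≠ 0))) = false := by
  refine xor3_decide_mod3' _ _ _ ?_ ?_ ?_ <;> unfold gapChar <;> split_ifs <;> omega

/-- **The light part is the complement of an elimination fail pattern.**  If every cut of `Lt`
lies outside the block interior and has degree `≤ D` towards the block, then on the fibre
`a ++ z ++ b` the parity of the selected live cuts of `Lt` is `T_{|z| mod 3}(z)` for an even
triple `T` of degree `D`; so its complement is a fail pattern of degree `≤ D`. -/
theorem isElimFail_not_lightPart {D : ℕ} (c : ℕ)
    (y : Fin (p + M + q + 1) → (Fin (p + M + q) → Bool) → Bool) (Lt : Finset (Fin (p + M + q + 1)))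
    (hLt : ∀ g ∈ Lt, (g.val ≤ p ∨ p + M ≤ g.val) ∧ HasDegTowards p M D (y g))
    (a : Fin p → Bool) (b : Fin q → Bool) :
    IsElimFail D (fun z : Fin M → Bool => !(decide ((Lt.filter fun g =>
      y g (glue3 a z b) = true ∧ (c + g.val + walkExp (glue3 a z b) g.val) % 3 ≠ 0).card % 2 = 1))) := by
  classical
  -- the even triple
  have hpat : ∀ z : Fin M → Bool, (Lt.filter fun g =>
      y g (glue3 a z b) = true ∧ (c + g.val + walkExp (glue3 a z b) g.val) % 3 ≠ 0) =
      Lt.filter fun g => (y g (glue3 a z b) && decide (gapChar M c a b g.val (wt z % 3) % 3 ≠ 0)) = true := by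
    intro z
    refine Finset.filter_congr fun g hg => ?_
    rw [char_glue3_eq_gapChar c a z b (hLt g hg).1, gapChar_mod M c a b g.val (wt z),
      Bool.and_eq_true, decide_eq_true_eq]
  refine (failCompl_iff_evenTriple M D _).2 ⟨fun r z => decide ((Lt.filter fun g =>
      (y g (glue3 a z b) && decide (gapChar M c a b g.val r % 3 ≠ 0)) = true).card % 2 = 1),
    ⟨fun r => ?_, fun z => ?_⟩, fun z => by rw [hpat z]⟩
  · exact hasDeg_parity _ (fun g (z : Fin M → Bool) =>
        y g (glue3 a z b) && decide (gapChar M c a b g.val r % 3 ≠ 0))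
      fun g hg => hasDeg_and_const' (hasDeg_glue3_of_towards (hLt g hg).2 a b) _
  · exact xor3_parity_of_pointwise _ (fun g => y g (glue3 a z b))
      (fun g => decide (gapChar M c a b g.val 0 % 3 ≠ 0))
      (fun g => decide (gapChar M c a b g.val 1 % 3 ≠ 0))
      (fun g => decide (gapChar M c a b g.val 2 % 3 ≠ 0))
      (fun g => gapChar_xor3 c a b g.val)

/-! ### The blind part under the pair flips -/

/-- **The blind part under a pair flip.**  For cuts `g` blind to the pair `{t, t+1}` and not equal
to `t + 1`, flipping `u_k` (`k = t` or `k = t + 1`) keeps the selectors and shifts the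
`σ`-shifted characters `c + g + |u| + W_g(u) + m_g σ` (`m_g = 1` for `g ≤ t`, `2` for `g ≥ t+2`)
to the `(σ + ε)`-shifted ones, `ε = 2` if `u_k = 1`, `ε = 1` if `u_k = 0`. -/
theorem blindPart_flip {n : ℕ} (c : ℕ) (y : Fin (n + 1) → (Fin n → Bool) → Bool)
    (Bl : Finset (Fin (n + 1))) (t : ℕ) (k : Fin n) (hk : k.val = t ∨ k.val = t + 1)
    (hBl : ∀ g ∈ Bl, BlindPair t (y g) ∧ (g.val ≤ t ∨ t + 2 ≤ g.val)) (u : Fin n → Bool) (σ : ℕ) :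
    (Bl.filter fun g => y g (Function.update u k (!u k)) = true ∧
      (c + g.val + walkExp (Function.update u k (!u k)) g.val + (if g.val ≤ t then 1 else 2) * σ)
        % 3 ≠ 0) =
    Bl.filter fun g => y g u = true ∧
      (c + g.val + walkExp u g.val + (if g.val ≤ t then 1 else 2) * (σ + (if u k = true then 2 else 1)))
        % 3 ≠ 0 := by
  refine Finset.filter_congr fun g hg => ?_
  obtain ⟨hblind, hgt⟩ := hBl g hg
  have hsel : y g (Function.update u k (!u k)) = y g u :=
    hblind _ _ fun i hi1 hi2 => Function.update_of_ne (fun h => by subst h; omega) _ _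
  have hchar := walkExp_flip_mod u k g.val (c + g.val)
  rw [hsel]
  generalize (if u k = true then 2 else 1) = ε at hchar ⊢
  rcases hgt with hgt | hgt
  · have hkg : ¬ k.val < g.val := by omega
    rw [if_neg hkg] at hchar
    simp only [Nat.add_zero, one_mul] at hchar
    rw [if_pos hgt]
    constructor <;> rintro ⟨h1, h2⟩ <;> exact ⟨h1, by omega⟩
  · have hkg : k.val < g.val := by omega
    have hgt' : ¬ g.val ≤ t := by omega
    rw [if_pos hkg] at hchar
    simp only [show (1 : ℕ) + 1 = 2 from rfl] at hchar
    rw [if_neg hgt']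
    constructor <;> rintro ⟨h1, h2⟩ <;> exact ⟨h1, by omega⟩

/-- The `σ`-shifted blind part depends on `σ` only mod `3`. -/
theorem blindPart_mod {n : ℕ} (c : ℕ) (y : Fin (n + 1) → (Fin n → Bool) → Bool)
    (Bl : Finset (Fin (n + 1))) (t : ℕ) (u : Fin n → Bool) (σ : ℕ) :
    (Bl.filter fun g => y g u = true ∧
      (c + g.val + walkExp u g.val + (if g.val ≤ t then 1 else 2) * σ) % 3 ≠ 0) =
    Bl.filter fun g => y g u = true ∧
      (c + g.val + walkExp u g.val + (if g.val ≤ t then 1 else 2) * (σ % 3)) % 3 ≠ 0 := by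
  refine Finset.filter_congr fun g _ => ?_
  by_cases hgt : g.val ≤ t
  · rw [if_pos hgt]; constructor <;> rintro ⟨h1, h2⟩ <;> exact ⟨h1, by omega⟩
  · rw [if_neg hgt]; constructor <;> rintro ⟨h1, h2⟩ <;> exact ⟨h1, by omega⟩

/-- **The three shifted blind parts form an even triple**: each cut is live for exactly two of
the shifts `0, m_g, 2 m_g`. -/
theorem blindPart_xor3 {n : ℕ} (c : ℕ) (y : Fin (n + 1) → (Fin n → Bool) → Bool)
    (Bl : Finset (Fin (n + 1))) (t : ℕ) (u : Fin n → Bool) :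
    xor (xor (decide ((Bl.filter fun g => y g u = true ∧
        (c + g.val + walkExp u g.val + (if g.val ≤ t then 1 else 2) * 0) % 3 ≠ 0).card % 2 = 1))
      (decide ((Bl.filter fun g => y g u = true ∧
        (c + g.val + walkExp u g.val + (if g.val ≤ t then 1 else 2) * 1) % 3 ≠ 0).card % 2 = 1)))
      (decide ((Bl.filter fun g => y g u = true ∧
        (c + g.val + walkExp u g.val + (if g.val ≤ t then 1 else 2) * 2) % 3 ≠ 0).card % 2 = 1)) =
      false := by
  classical
  have key := xor3_parity_of_pointwise Bl (fun g => y g u)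
    (fun g => decide ((c + g.val + walkExp u g.val + (if g.val ≤ t then 1 else 2) * 0) % 3 ≠ 0))
    (fun g => decide ((c + g.val + walkExp u g.val + (if g.val ≤ t then 1 else 2) * 1) % 3 ≠ 0))
    (fun g => decide ((c + g.val + walkExp u g.val + (if g.val ≤ t then 1 else 2) * 2) % 3 ≠ 0))
    (fun g => by
      refine xor3_decide_mod3' _ _ _ ?_ ?_ ?_ <;> split_ifs <;> omega)
  have hset : ∀ r : ℕ, (Bl.filter fun g => y g u = true ∧
      (c + g.val + walkExp u g.val + (if g.val ≤ t then 1 else 2) * r) % 3 ≠ 0) =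
      Bl.filter fun g => (y g u &&
        decide ((c + g.val + walkExp u g.val + (if g.val ≤ t then 1 else 2) * r) % 3 ≠ 0)) = true := by
    intro r
    refine Finset.filter_congr fun g _ => ?_
    rw [Bool.and_eq_true, decide_eq_true_eq]
  rw [hset 0, hset 1, hset 2, Bool.xor_assoc]
  exact key

end Summit.QuantumAdvantage.AdviceFreeQNC0
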